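import Summits.ValiantsHypothesis.ValiantsHypothesis.Theorems.BarrierLeverDefinableDcEquationsDegreeThreshold

/-!
# Route BarrierLever — item `SuccinctHittingSetsForVBP` (stmt-ValiantsHypothesis-18966): every
# witness has `dc`-exponent `b ≥ 2` at levels `a ≥ 81`

Item 18966 ("VBP-succinct hitting sets exist") reads `∀ a, ∃ b n₀, ∀ n ≥ n₀`: the degree-`≤ n`
polynomials of determinantal complexity `≤ n^b` hit `Distinguishers ℂ n a`.  By the unconditional
natural proof against `dc = deg` of `…DefinableDcEquationsDegreeThreshold.lean`
(`DcEqualsDegree.not_isSuccinctHittingSet_dc_le_self`: for `n ≥ 5` the slice `dc ≤ n` does not hit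
`Distinguishers ℂ n 81`), any witness `(b, n₀)` at a level `a ≥ 81` must have `b ≥ 2`: for `b ≤ 1`
the slice `dc ≤ n^b` lies inside `dc ≤ n`, and hitting sets pass to supersets of the class and to
sub-classes of the distinguishers.  A `dc`-axis analogue of the KRST no-go bands (items 19093 /
19340: `b < 6c`, `b < 12c` on the `VP` axis) — here a band of width one, `b ∉ {0, 1}`.

Honest framing: this does not decide item 18966; nothing here bears on `VP` vs `VNP`.
-/

-- layout Summits/ValiantsHypothesis/ValiantsHypothesis forces the duplicated namespace component
set_option linter.dupNamespace false

noncomputable section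

namespace Summit.ValiantsHypothesis.ValiantsHypothesis.Theorems.BarrierLever.SuccinctHittingSetsForVBP

open Literature.Computability.AlgebraicComplexity Literature.Barriers.ValiantsHypothesis
open Summit.ValiantsHypothesis.ValiantsHypothesis.Theorems.BarrierLever.DcEqualsDegree

/-- **Every witness of `SuccinctHittingSetsForVBP` at a level `a ≥ 81` has `dc`-exponent `b ≥ 2`.**
If for some `b, n₀` the slices `{deg f ≤ n, dc f ≤ n^b}`, `n ≥ n₀`, hit `Distinguishers ℂ n a` with
`81 ≤ a`, then `2 ≤ b`: otherwise `n^b ≤ n` and at `n = max n₀ 5` the larger slice `dc ≤ n` would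
hit the smaller class `Distinguishers ℂ n 81` (`IsSuccinctHittingSet.mono`), contradicting
`DcEqualsDegree.not_isSuccinctHittingSet_dc_le_self`. [cite: AlperBogartVelasco2017, Thm. 1.7] -/
theorem two_le_of_witness {a b n₀ : ℕ} (ha : 81 ≤ a)
    (h : ∀ n : ℕ, n₀ ≤ n → IsSuccinctHittingSet (degLEMonomials n)
      {f : MvPolynomial (Fin n) ℂ | f.totalDegree ≤ n ∧ determinantalComplexity f ≤ n ^ b}
      (Distinguishers ℂ n a)) :
    2 ≤ b := by
  by_contra hb
  push Not at hb
  set n := max n₀ 5 with hn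
  have h5 : 5 ≤ n := le_max_right _ _
  have hpow : n ^ b ≤ n ^ 1 := Nat.pow_le_pow_right (by omega) (by omega)
  have hsub : {f : MvPolynomial (Fin n) ℂ | f.totalDegree ≤ n ∧ determinantalComplexity f ≤ n ^ b} ⊆
      {f : MvPolynomial (Fin n) ℂ | f.totalDegree ≤ n ∧ determinantalComplexity f ≤ n ^ 1} :=
    fun f hf => ⟨hf.1, hf.2.trans hpow⟩
  have hmono : Distinguishers ℂ n 81 ⊆ Distinguishers ℂ n a := by
    intro D hD
    have hN : (Nat.choose (2 * n) n) ^ 81 ≤ (Nat.choose (2 * n) n) ^ a :=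
      Nat.pow_le_pow_right (Nat.choose_pos (by omega)) ha
    exact ⟨hD.1.trans hN, hD.2.trans hN⟩
  exact not_isSuccinctHittingSet_dc_le_self h5 ((h n (le_max_left _ _)).mono hsub hmono)

/-- The same in the item's words: at every level `a ≥ 81`, NO `b ≤ 1` is a witness of
`SuccinctHittingSetsForVBP` (for any `n₀`). [cite: AlperBogartVelasco2017, Thm. 1.7] -/
theorem no_witness_of_le_one {a b : ℕ} (ha : 81 ≤ a) (hb : b ≤ 1) (n₀ : ℕ) :
    ¬ ∀ n : ℕ, n₀ ≤ n → IsSuccinctHittingSet (degLEMonomials n)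
      {f : MvPolynomial (Fin n) ℂ | f.totalDegree ≤ n ∧ determinantalComplexity f ≤ n ^ b}
      (Distinguishers ℂ n a) :=
  fun h => absurd (two_le_of_witness ha h) (by omega)

end Summit.ValiantsHypothesis.ValiantsHypothesis.Theorems.BarrierLever.SuccinctHittingSetsForVBP

end
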